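import Literature.MathematicalPhysics.QuantumFieldTheory.Balaban1983to89.Node00.OpsYSectEElimSmall
import Literature.MathematicalPhysics.QuantumFieldTheory.Balaban1983to89.Node00.OpsYSectEElimAxial
import HarnessLib

/-!
# `Balaban1983to89.B1Eq324BenfattoClassSectEMemberERowsAtNode00` — THE `E`-ROWS OF THE (3.24) PRECISION DOOR AT NODE 00's GENUINE `C(V)`:
# locality radius and column mass of T. Bałaban's bond-elimination operator `C` of *Propagators for lattice gauge theories in a background field*,
# Commun. Math. Phys. **99** (1985) 389–434 [Balaban1985BackgroundPropagators], Sect. E (3.157) p. 428, as built on NODE 00's carrier by def-Y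
# (`Node00.OpsYSectEElim.elimCY`)

statement-level companion of published sources with citation tags; every declaration here is a theorem; nothing here is a claim about the
Yang–Mills mass gap

WHY THIS MODULE (cell `pub-ymgap`, seat `dag-n08-d` gen 30, CLAIM-84; node N08 [Balaban1985UV3], the (α)-row `h324` behind [Balaban1985UV3] (3.24)).
Seat n08-b's `B1Eq324BenfattoClassSectEMemberCoReadProduct.eq324_CsDeltaCY_precision_node00_on_unit` (p669260) states [Balaban1982Higgs1] (3.24) for the
Gaussian `𝒩(0, 𝕄_Λ̃(C*Δ_kC)⁻¹)` of [Balaban1985BackgroundPropagators] (3.155)–(3.158) AT NODE 00's NAMED LETTERS (def-Y's `Node00.OpsYSectE`: `CsDeltaCY`,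
`elimCΛY`, `elimCtΛY`, …) with five operator rows DISPLAYED as hypotheses.  Two of them — row (R4′) — concern the letter `C` alone:
* `hloc`  : `∀ s w u, elimCΛY x 𝔢 U (Pi.single (ι s) w) u ≠ 0 → unitDistY x u (ι s) ≤ r` (LOCALITY of `P_Λ C P_Λ̃` along `ι`), and
* `hmass` : `∀ s c′, ∑ u, ‖elimCΛY x 𝔢 U (Pi.single (ι s) (b c′)) u‖ ≤ m` (COLUMN MASS).
Print, p. 428: *«we define the linear operator C by B = CB̃ (3.157).  It is an identity operator on almost all bonds, except the bonds b₀ where (CB)(b₀) is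
equal to a solution of the equation (QB)(c) = 0»*, and [Balaban1985Averaging] (125) p. 36: *«(Q₀A)_c = Σ_{x∈B(c₋)} L^{−d} (R_{0,c₋}A)([x, x(c)])»* — so the row
of `C` at a pivot `b₀(c)` reads only the `L·L^{d+1}` unit bonds of the straight segments `[z, z(c)]`, `z ∈ B(c₋)`, each with a coefficient
`−K_c(V)⁻¹ · L^{−(d+2)} · (transport)`.  def-Y's `Node00.OpsYSectEElim` BUILDS this `C(V) = elimCY x 𝔳` on NODE 00's bond carrier
(`C(V) = P_{Λ̃} − Σ_{c ∈ Λ′} (δ_{b₀(c)} ⊗ ·) ∘ K_c(V)⁻¹ ∘ Q(V)_c ∘ P_{Λ̃}`), and at the seven-letter record `sectELettersYOfRecordTC x 𝔳 𝔢₀` the door's dressed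
letter `elimCΛY` IS `elimCY x 𝔳` (`elimCΛY_sectELettersYOfRecordTC`).  THIS FILE proves the two rows for that genuine `C(V)`:
* §3 ★★ `unitDistY_le_of_elimCY_single_ne_zero` — LOCALITY, EVERY background `U`, NO hypothesis: `elimCY x 𝔳 U (δ_q ⊗ w) u ≠ 0 → |y_u − y_q| ≤ ℓ + 2`
  (`|y − y′|` = def-Y's `unitDistY`, the distance of Thm 3.15 (3.187) in the tree; `ℓ + 2 = (L − 1) + 2`: the pivot `b₀(c)` and a segment bond it reads
  lie in the double block `B(c₋) ∪ B(c₊)`, plus one unit at each end for the `k`-label of an index bond vs. its source, §2);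
* §4 ★★ `sum_norm_elimCY_single_le_of_contract` — COLUMN MASS for contracting transports `‖R(V(b))v‖ ≤ ‖v‖` (e.g. `G`-valued `V` with `‖g‖ ≤ 1`, def-Y's
  `hG1 ∕ h𝔳` currency: `sum_norm_elimCY_single_le`) and a PIVOT-INVERSE ROW `‖K_c(V)⁻¹a‖ ≤ κ_K·L^{d+1}·‖a‖`: `Σ_u ‖elimCY x 𝔳 U (δ_q ⊗ w) u‖ ≤ (1 + κ_K)·‖w‖`
  (a unit bond is read by at most `L` (coarse bond, block site) pairs, §2 `sum_sum_occY_usegY_le`, each with weight `L^{−(d+2)}`); the pivot-inverse row is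
  DISCHARGED at `U = 1` (`inverse_KY_one_apply`: `K_c(1)⁻¹ = L^{d+1}·id`, so `κ_K = 1`) and in def-Y's small-field regime `SmallVY`
  (`norm_inverse_KY_apply_le_of_smallVY`: `κ_K = (1 − κ)⁻¹`, `κ := L^{d+1}·2δ(L + (d+1)ℓ) < 1`, from `norm_KY_sub_le` + the unit property — §1
  `norm_inverse_apply_le_of_norm_smul_sub_le`, the norm companion of def-Y's `isUnit_of_norm_smul_sub_le`);
* §5 THE CONSUMER's SHAPES: `local_elimCΛY_ofRecordTC` ∕ `colMass_elimCΛY_ofRecordTC_of_contract` (+ `_one`, `_of_smallVY`) are p669260's `hloc` ∕ `hmass`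
  binders VERBATIM at `𝔢 := sectELettersYOfRecordTC x 𝔳 𝔢₀`, with `r := ℓ + 2` and `m := (1 + κ_K)·n_e` for any family `b : κ → 𝔸` with `‖b c′‖ ≤ n_e`;
  §6 the record-level editions at def-Y's v6 Sect. E letters `sectEYOfRecordV6` (fibre `M_N(ℂ)`, `G ≤ U(N)`).

EDITION v1.1 (same seat, INTENT-85; append-only, §7): the pivot-inverse row and the column mass in print's SMALL-CURVATURE regime (3.35) — local
smallness on the read bonds suffices (`norm_inverse_KY_apply_le_of_small_on`, def-Y's `KY_congr`), the norm of `K_c(V)⁻¹` is a gauge-orbit quantity for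
gauges valued in a group of contractions (`ringInverse_KY_ugauge`, the `K_c` twin of def-Y's `ringInverse_KTY_ugauge`; `norm_inverse_KY_apply_le_of_ugauge`),
and def-Y's axial gauge of the double block (`Node00.OpsYSectEElimAxial`: `axialY`, `norm_ugaugeY_axialY_sub_one_le`) makes a small-curvature field small there:
★★ `norm_inverse_KY_apply_le_of_plaqSmall`, ★★ `sum_norm_elimCY_single_le_of_plaqSmall`, `colMass_elimCΛY_ofRecordTC_of_plaqSmall`, v6
`colMass_elimC_sectEYOfRecordV6_of_plaqSmall` (`G ≤ U(N)`).

HONEST SCOPE.  Count-neutral finite combinatorics and norm bookkeeping over def-Y's certified letters (`Node00.OpsYSectELetters` ∕ `OpsYSectEElim` ∕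
`OpsYSectEElimSmall`); two DISPLAYED rows (R4′) of n08-b's door become theorems at NODE 00's letters; the door's other rows (R1′) (R2′) (R3′) (R5′) — node
N06's (3.132) ∕ G-B9-09 content and the β-vs-trace adjointness junction — are NOT touched; the pivot-inverse row at a general background stays a displayed
small-field input (print's regime is small CURVATURE (3.35), reduced to small fields by an axial gauge — not formalised here, as in def-Y's margin); the
constants (`ℓ + 2`, `1 + κ_K`) depend on `d, L` only and are cruder than print's.  No letter is pinned or constructed here; the tower datum's step measure
`(𝔖 k).μ` is NOT pinned and the IDENT is NOT made; `PrintedUV3V` ∕ row `h324c` NOT discharged; node N08 NOT discharged; one finite 𝕋^{d+1} programme —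
nothing about d = 4 specifically, the continuum, OS axioms, a mass gap or the Clay problem.  No `sorry`, no `def`, no `instance`, no `notation`.
-/

noncomputable section

open Finset

namespace Literature.MathematicalPhysics.QuantumFieldTheory.Balaban1983to89.B1Eq324BenfattoClassSectEMemberERowsAtNode00

open Literature.MathematicalPhysics.QuantumFieldTheory
open Literature.MathematicalPhysics.QuantumFieldTheory.Balaban1983to89.B9Eq3169Mu (hol trSum hol_cons_apply trSum_cons trSum_nil hol_nil trSum_eq_zero)
open Literature.MathematicalPhysics.QuantumFieldTheory.Balaban1983to89.B9Eq39Adjoint (R R_one)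
open Literature.MathematicalPhysics.QuantumFieldTheory.Balaban1983to89.B9PinMembersKLevelV1 (MemberY)
open Literature.MathematicalPhysics.QuantumFieldTheory.Balaban1983to89.B9PinGeometryKLevelV1 (kLab unitDistY)
open Literature.MathematicalPhysics.QuantumFieldTheory.Balaban1983to89.B6BondElimination (unitVec unitVec_apply)
open Literature.MathematicalPhysics.QuantumFieldTheory.Balaban1983to89.B6Elimination (corner mem_block)
open Literature.MathematicalPhysics.QuantumFieldTheory.Balaban1983to89.B6GlobalChartV1 (PV domT)
open Literature.MathematicalPhysics.QuantumFieldTheory.Balaban1983to89.B9Thm314GpFlatTorusGeometry (tdistK)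
open Literature.MathematicalPhysics.QuantumFieldTheory.Balaban1983to89.B9Thm314QGGQInvFlatTransfer (tdistK_triangle tdistK_comm)
open Literature.MathematicalPhysics.QuantumFieldTheory.Balaban1983to89.B9Thm314GpFlatOmegaOff (tdistK_self)
open Literature.MathematicalPhysics.QuantumFieldTheory.Balaban1983to89.Node00

variable {d ℓ : ℕ} {hd : 1 ≤ d + 1} {hL : Odd (ℓ + 1) ∧ 1 < ℓ + 1} {w₀ w₁ : ℝ} {Mstar : ℕ}

/-! ## §1  Two generic estimates: one-bond readings along a contour; the norm of the inverse of a near-scalar unit -/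

section Generic

/-- **A ONE-BOND READING TRANSPORTED ALONG A CONTOUR**: if the bond function `B` is bounded by `M` at `b₀` and vanishes elsewhere, and the bond transports
contract, then `‖(R_y(V)B)(Γ)‖ ≤ #(b₀ ∈ Γ)·M` (the `δ_q ⊗ a` case is def-Y's `norm_trSum_sgl_le`).
[cite: Balaban1985BackgroundPropagators, (3.169) p.430; Balaban1985Averaging, (125) p.36, bookkeeping] -/
theorem norm_trSum_le_occY_mul {Bond 𝔤 : Type} [DecidableEq Bond] [NormedAddCommGroup 𝔤] [NormedSpace ℝ 𝔤] (T : Bond → 𝔤 ≃ₗ[ℝ] 𝔤)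
    (hT : ∀ b v, ‖T b v‖ ≤ ‖v‖) (B : Bond → 𝔤) (b₀ : Bond) {M : ℝ} (hB : ∀ b, ‖B b‖ ≤ if b = b₀ then M else 0) :
    ∀ Γ : List Bond, ‖trSum T B Γ‖ ≤ occY b₀ Γ * M
  | [] => by simp [occY]
  | b :: Γ => by
      rw [trSum_cons, occY, add_mul]
      refine (norm_add_le _ _).trans (add_le_add ?_ ((hT b _).trans (norm_trSum_le_occY_mul T hT B b₀ hB Γ)))
      have h := hB b
      by_cases hb : b = b₀
      · rw [if_pos hb] at h; rw [if_pos hb, one_mul]; exact h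
      · rw [if_neg hb] at h; rw [if_neg hb, zero_mul]; exact h

/-- **THE INVERSE OF A NEAR-SCALAR UNIT IS BOUNDED**: an invertible endomorphism `K` of the fibre with `‖(λK)a − a‖ ≤ κ‖a‖`, `κ < 1`, has
`‖K⁻¹a‖ ≤ ‖λ‖(1 − κ)⁻¹‖a‖` — the norm companion of def-Y's Neumann lemma `isUnit_of_norm_smul_sub_le` (from `K(K⁻¹a) = a` alone: `v := K⁻¹a` satisfies
`‖λa − v‖ ≤ κ‖v‖`). [cite: Balaban1985BackgroundPropagators, (3.35) p.397, p.428, bookkeeping] -/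
theorem norm_inverse_apply_le_of_norm_smul_sub_le {𝔸 : Type} [NormedRing 𝔸] [NormedAlgebra ℂ 𝔸] (K : Module.End ℂ 𝔸) (hK : IsUnit K) {Lp : ℂ} {κ : ℝ}
    (hκ1 : κ < 1) (hdev : ∀ a : 𝔸, ‖(Lp • K) a - a‖ ≤ κ * ‖a‖) (a : 𝔸) :
    ‖Ring.inverse K a‖ ≤ ‖Lp‖ / (1 - κ) * ‖a‖ := by
  have hKv : K (Ring.inverse K a) = a := by
    have h := congrArg (fun T : Module.End ℂ 𝔸 => T a) (Ring.mul_inverse_cancel K hK)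
    simpa only [Module.End.mul_apply, Module.End.one_apply] using h
  have h2 : ‖Ring.inverse K a‖ ≤ ‖Lp‖ * ‖a‖ + κ * ‖Ring.inverse K a‖ := by
    have h := hdev (Ring.inverse K a)
    rw [LinearMap.smul_apply, hKv] at h
    calc ‖Ring.inverse K a‖ = ‖Lp • a - (Lp • a - Ring.inverse K a)‖ := by rw [sub_sub_cancel]
      _ ≤ ‖Lp • a‖ + ‖Lp • a - Ring.inverse K a‖ := norm_sub_le _ _
      _ ≤ ‖Lp‖ * ‖a‖ + κ * ‖Ring.inverse K a‖ := add_le_add (norm_smul_le _ _) h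
  have hκ' : 0 < 1 - κ := sub_pos.2 hκ1
  rw [div_mul_eq_mul_div, le_div_iff₀ hκ']
  have e : ‖Ring.inverse K a‖ * (1 - κ) = ‖Ring.inverse K a‖ - κ * ‖Ring.inverse K a‖ := by ring
  rw [e]
  linarith

end Generic

/-! ## §2  Geometry of the readings of `Q(V)_c`: which unit bonds the pivot row of `C` reads, how many times, and how far they are -/

section Readings

variable {𝔸 : Type} [NormedRing 𝔸] [NormedAlgebra ℂ 𝔸] [CompleteSpace 𝔸]
variable (x : MemberY d ℓ hd hL w₀ w₁ Mstar)

omit [CompleteSpace 𝔸] in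
/-- `P_S(δ_q ⊗ w) = δ_q ⊗ w` for `q ∈ S`. [cite: Balaban1985BackgroundPropagators, p.428 («B̃ defined on Λ̃»), bookkeeping] -/
theorem secY_single_of {X : Type} [DecidableEq X] {S : X → Prop} {q : X} (hq : S q) (w : 𝔸) :
    secY 𝔸 S (Pi.single q w) = Pi.single q w := by
  funext u
  by_cases hS : S u
  · rw [secY_apply_of hS]
  · rw [secY_apply_of_not hS, Pi.single_eq_of_ne]
    rintro rfl
    exact hS hq

omit [CompleteSpace 𝔸] in
/-- `P_S(δ_q ⊗ w) = 0` for `q ∉ S`. [cite: Balaban1985BackgroundPropagators, p.428 («B̃ defined on Λ̃»), bookkeeping] -/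
theorem secY_single_of_not {X : Type} [DecidableEq X] {S : X → Prop} {q : X} (hq : ¬ S q) (w : 𝔸) :
    secY 𝔸 S (Pi.single q w) = 0 := by
  funext u
  by_cases hS : S u
  · rw [secY_apply_of hS, Pi.zero_apply, Pi.single_eq_of_ne]
    rintro rfl
    exact hq hS
  · rw [secY_apply_of_not hS, Pi.zero_apply]

/-- **`C(V)` READS `Λ̃` ONLY**: `C(V)(δ_q ⊗ w) = 0` for `q ∉ Λ̃` (`C P_{Λ̃} = C`). [cite: Balaban1985BackgroundPropagators, (3.157) p.428, bookkeeping] -/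
theorem elimCY_single_of_not_lamTY (𝔳 : AvY 𝔸 x) [DecidableEq (IBondY x.toKIdx)] (U : CfgY 𝔸 x.toKIdx) {q : IBondY x.toKIdx} (hq : ¬ lamTY x q) (w : 𝔸) :
    elimCY x 𝔳 U (Pi.single q w) = 0 := by
  rw [← elimCY_mul_secY, Module.End.mul_apply, secY_single_of_not hq, map_zero]

open Classical in
omit [NormedAlgebra ℂ 𝔸] [CompleteSpace 𝔸] in
/-- **THE UNIT-BOND READING OF `δ_q ⊗ w`** is bounded by `‖w‖` at the unit bond of `q` and vanishes elsewhere. [cite: Balaban1984PropagatorsII, (2.3) p.224; Balaban1985BackgroundPropagators, (3.157) p.428, bookkeeping] -/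
theorem norm_readUY_single_le [DecidableEq (IBondY x.toKIdx)] (q : IBondY x.toKIdx) (w : 𝔸) (b : UBondY x) :
    ‖readUY x (Pi.single q w) b‖ ≤ if b = ubondOfIdx x q then ‖w‖ else 0 := by
  by_cases h : b.src ∈ (domT x.hN x.D x.hk).Om x.k
  · rw [readUY_apply_of_mem x _ h]
    by_cases hq : idxOfU x b h = q
    · have hb : b = ubondOfIdx x q := by rw [← hq, ubondOfIdx_idxOfU]
      rw [if_pos hb, hq, Pi.single_eq_same]
    · rw [Pi.single_eq_of_ne hq, norm_zero]
      split_ifs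
      · exact norm_nonneg w
      · exact le_rfl
  · rw [readUY_apply_of_not_mem x _ h, norm_zero]
    split_ifs
    · exact norm_nonneg w
    · exact le_rfl

omit hd hL in
/-- occurrences in a contour listed by an index map. [cite: Balaban1985Averaging, (14) p.19, bookkeeping] -/
theorem occY_map_range {Bond : Type} [DecidableEq Bond] (q : Bond) :
    ∀ (n : ℕ) (f : ℕ → Bond), occY q ((List.range n).map f) = ∑ s ∈ Finset.range n, if f s = q then (1 : ℝ) else 0
  | 0, f => by simp [occY]
  | n + 1, f => by
      rw [List.range_succ_eq_map, List.map_cons, List.map_map, occY, occY_map_range q n (f ∘ Nat.succ), Finset.sum_range_succ']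
      simp only [Function.comp_apply, Nat.succ_eq_add_one]
      exact add_comm _ _

open Classical in
/-- **OCCURRENCES IN A SEGMENT**: `#(b₀ ∈ [z, z + L e_μ]) = Σ_{s < L} [⟨z + s e_μ, μ⟩ = b₀]`. [cite: Balaban1985Averaging, (14) p.19, (125) p.36, bookkeeping] -/
theorem occY_usegY (b₀ : UBondY x) (z : USiteY x) (μ : Fin (d + 1)) :
    occY b₀ (usegY x z μ) = ∑ s ∈ Finset.range (ℓ + 1), if (⟨ofZ x (labK x z + ((s : ℕ) : ℤ) • unitVec μ), μ⟩ : UBondY x) = b₀ then (1 : ℝ) else 0 :=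
  occY_map_range b₀ (ℓ + 1) _

/-- chart algebra: `z + v = t` on the unit torus forces `z = t − v`. [cite: Balaban1984PropagatorsII, (2.1) p.224, bookkeeping] -/
theorem eq_ofZ_of_ofZ_labK_add_eq {z t : USiteY x} {v : Fin (d + 1) → ℤ} (e : ofZ x (labK x z + v) = t) : z = ofZ x (labK x t - v) := by
  have e2 : ofZ x (labK x z) = ofZ x (labK x t - v) := by
    funext i
    have ei := congrFun e i
    have et : ofZ x (labK x t) i = t i := by rw [ofZ_labK]
    simp only [ofZ_apply, Pi.add_apply, Pi.sub_apply, Int.cast_add, Int.cast_sub] at ei et ⊢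
    rw [et, ← ei]
    ring
  rwa [ofZ_labK] at e2

/-- a block point's corner is the block's corner. [cite: Balaban1985Averaging, p.24, bookkeeping] -/
theorem ucorner_eq_of_mem_ublockY {y z : USiteY x} (hy : IsCornerY x y) (hz : z ∈ ublockY x y) : ucorner x z = y := by
  unfold ucorner
  rw [(mem_ublockY x).1 hz, (isCornerY_iff x y).1 hy, ofZ_labK]

open Classical in
/-- **EACH (segment index) READS A UNIT BOND AT MOST ONCE OVER ALL (coarse bond, block site) PAIRS**: for fixed `s < L`, at most one pair `(c, z)`,
`c ∈ Λ′`, `z ∈ B(c₋)`, has `⟨z + s e_{μ(c)}, μ(c)⟩ = b₀` (`z = b₀₋ − s e_μ` and `c₋` is the corner of its block).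
[cite: Balaban1985Averaging, (125) p.36; Balaban1985BackgroundPropagators, p.428, bookkeeping] -/
theorem sum_sum_ite_usegY_le_one (b₀ : UBondY x) (s : ℕ) :
    ∑ c : CBondY x, ∑ z ∈ ublockY x c.1.1,
      (if (⟨ofZ x (labK x z + ((s : ℕ) : ℤ) • unitVec c.1.2), c.1.2⟩ : UBondY x) = b₀ then (1 : ℝ) else 0) ≤ 1 := by
  set z₀ : USiteY x := ofZ x (labK x b₀.src - ((s : ℕ) : ℤ) • unitVec b₀.dir) with hz₀
  set c₀ : USiteY x × Fin (d + 1) := (ucorner x z₀, b₀.dir) with hc₀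
  have hterm : ∀ (c : CBondY x) (z : USiteY x), z ∈ ublockY x c.1.1 →
      (if (⟨ofZ x (labK x z + ((s : ℕ) : ℤ) • unitVec c.1.2), c.1.2⟩ : UBondY x) = b₀ then (1 : ℝ) else 0) ≤
        if c.1 = c₀ ∧ z = z₀ then 1 else 0 := by
    intro c z hz
    by_cases h : (⟨ofZ x (labK x z + ((s : ℕ) : ℤ) • unitVec c.1.2), c.1.2⟩ : UBondY x) = b₀
    · have hμ : c.1.2 = b₀.dir := congrArg PBond.dir h
      have hsrc : ofZ x (labK x z + ((s : ℕ) : ℤ) • unitVec c.1.2) = b₀.src := congrArg PBond.src h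
      have hzz : z = z₀ := by rw [hz₀, ← hμ]; exact eq_ofZ_of_ofZ_labK_add_eq x hsrc
      have hcc : c.1 = c₀ := by
        rw [hc₀, ← hzz]
        exact Prod.ext (ucorner_eq_of_mem_ublockY x (isCoarseY_of x c).1 hz).symm hμ
      rw [if_pos h, if_pos ⟨hcc, hzz⟩]
    · rw [if_neg h]
      split_ifs
      · exact zero_le_one
      · exact le_rfl
  have hc : ∀ c : CBondY x, ∑ z ∈ ublockY x c.1.1, (if c.1 = c₀ ∧ z = z₀ then (1 : ℝ) else 0) ≤ if c.1 = c₀ then 1 else 0 := by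
    intro c
    by_cases hcc : c.1 = c₀
    · rw [if_pos hcc]
      calc ∑ z ∈ ublockY x c.1.1, (if c.1 = c₀ ∧ z = z₀ then (1 : ℝ) else 0)
          = ∑ z ∈ ublockY x c.1.1, (if z = z₀ then (1 : ℝ) else 0) := Finset.sum_congr rfl fun z _ => by simp only [hcc, true_and]
        _ ≤ ∑ z, (if z = z₀ then (1 : ℝ) else 0) :=
            Finset.sum_le_univ_sum_of_nonneg fun z => by positivity
        _ = 1 := by rw [Finset.sum_ite_eq' Finset.univ z₀, if_pos (Finset.mem_univ _)]
    · rw [if_neg hcc]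
      exact (Finset.sum_eq_zero fun z _ => by rw [if_neg fun h => hcc h.1]).le
  have h1 : ∑ c : CBondY x, (if c.1 = c₀ then (1 : ℝ) else 0) ≤ 1 := by
    by_cases h0 : c₀ ∈ coarseY x
    · have e : ∀ c : CBondY x, (if c.1 = c₀ then (1 : ℝ) else 0) = if c = ⟨c₀, h0⟩ then 1 else 0 := by
        intro c
        by_cases hcc : c = ⟨c₀, h0⟩
        · rw [if_pos hcc, if_pos (by rw [hcc])]
        · rw [if_neg hcc, if_neg (fun h => hcc (Subtype.ext h))]
      rw [Finset.sum_congr rfl fun c _ => e c, Finset.sum_ite_eq' Finset.univ (⟨c₀, h0⟩ : CBondY x), if_pos (Finset.mem_univ _)]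
    · refine (Finset.sum_eq_zero fun c _ => ?_).le.trans zero_le_one
      rw [if_neg]
      intro h
      exact h0 (h ▸ c.2)
  exact ((Finset.sum_le_sum fun c _ => (Finset.sum_le_sum fun z hz => hterm c z hz).trans (hc c))).trans h1

/-- ★ **A UNIT BOND IS READ AT MOST `L` TIMES BY ALL THE PIVOT ROWS TOGETHER**: `Σ_{c ∈ Λ′} Σ_{z ∈ B(c₋)} #(b₀ ∈ [z, z(c)]) ≤ L` (the segments through `b₀` in its
direction start at the `L` sites `b₀₋ − s e_μ`, `s < L`, each in exactly one block). [cite: Balaban1985Averaging, (125) p.36; Balaban1985BackgroundPropagators, (3.157) p.428, bookkeeping] -/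
theorem sum_sum_occY_usegY_le (b₀ : UBondY x) :
    ∑ c : CBondY x, ∑ z ∈ ublockY x c.1.1, occY b₀ (usegY x z c.1.2) ≤ ((ℓ + 1 : ℕ) : ℝ) := by
  classical
  simp_rw [occY_usegY]
  calc ∑ c : CBondY x, ∑ z ∈ ublockY x c.1.1, ∑ s ∈ Finset.range (ℓ + 1),
          (if (⟨ofZ x (labK x z + ((s : ℕ) : ℤ) • unitVec c.1.2), c.1.2⟩ : UBondY x) = b₀ then (1 : ℝ) else 0)
      = ∑ s ∈ Finset.range (ℓ + 1), ∑ c : CBondY x, ∑ z ∈ ublockY x c.1.1,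
          (if (⟨ofZ x (labK x z + ((s : ℕ) : ℤ) • unitVec c.1.2), c.1.2⟩ : UBondY x) = b₀ then (1 : ℝ) else 0) := by
        rw [Finset.sum_comm]
        exact Finset.sum_congr rfl fun c _ => Finset.sum_comm
    _ ≤ ∑ _s ∈ Finset.range (ℓ + 1), (1 : ℝ) := Finset.sum_le_sum fun s _ => sum_sum_ite_usegY_le_one x b₀ s
    _ = ((ℓ + 1 : ℕ) : ℝ) := by rw [Finset.sum_const, Finset.card_range, nsmul_eq_mul, mul_one]

omit [NormedAlgebra ℂ 𝔸] [CompleteSpace 𝔸] [NormedRing 𝔸] in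
/-- **THE PIVOT AND A SEGMENT BOND IT READS LIE IN ONE DOUBLE BLOCK**: for a corner `c₋`, `z ∈ B(c₋)` and `b ∈ [z, z(c)]`, the sources of `b₀(c)` and `b` are at
`|y − y′| ≤ ℓ = L − 1` on `T₁^{(k)}`. [cite: Balaban1985BackgroundPropagators, p.428, (3.187) p.432; Balaban1985Averaging, (125) p.36, bookkeeping] -/
theorem tdistK_upivU_src_le_of_mem_usegY {c : USiteY x × Fin (d + 1)} (hc : IsCornerY x c.1) {z : USiteY x} (hz : z ∈ ublockY x c.1)
    {b : UBondY x} (hb : b ∈ usegY x z c.2) :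
    tdistK (ℓ := ℓ) (Mh := x.Mh) (k := x.k) (P := x.P') (labK x (upivU x c).src) (labK x b.src) ≤ ℓ := by
  obtain ⟨s, hs, rfl⟩ := (mem_usegY x).1 hb
  show tdistK (ℓ := ℓ) (Mh := x.Mh) (k := x.k) (P := x.P') (labK x (ofZ x (labK x c.1 + (ℓ : ℤ) • unitVec c.2)))
    (labK x (ofZ x (labK x z + ((s : ℕ) : ℤ) • unitVec c.2))) ≤ ℓ
  refine tdistK_labK_ofZ_le x (Nat.cast_nonneg ℓ) fun μ => ?_
  have hzb := labK_mem_block_of_mem_ublockY x hz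
  rw [(isCornerY_iff x _).1 hc] at hzb
  obtain ⟨h1, h2⟩ := (mem_block.1 hzb) μ
  have hs' : s ≤ ℓ := Nat.lt_succ_iff.1 hs
  have hi : |(labK x z + ((s : ℕ) : ℤ) • unitVec c.2) μ - (labK x c.1 + (ℓ : ℤ) • unitVec c.2) μ| ≤ (ℓ : ℤ) := by
    simp only [Pi.add_apply, Pi.smul_apply, unitVec_apply, smul_eq_mul]
    split_ifs
    · rw [abs_le]; constructor <;> push_cast at h2 ⊢ <;> omega
    · rw [abs_le]; constructor <;> push_cast at h2 ⊢ <;> omega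
  exact_mod_cast hi

omit [NormedAlgebra ℂ 𝔸] [CompleteSpace 𝔸] [NormedRing 𝔸] in
/-- ★ **A PIVOT AND AN INDEX BOND ITS ROW READS ARE AT `|y − y′| ≤ ℓ + 2`** (def-Y's `unitDistY`: the `k`-label of an index bond is within `1` of its source's,
`tdistK_kLab_usrc_le`). [cite: Balaban1985BackgroundPropagators, (3.157) p.428, (3.187) p.432, bookkeeping] -/
theorem unitDistY_pivIY_le_of_mem_usegY (c : CBondY x) {z : USiteY x} (hz : z ∈ ublockY x c.1.1) {b : UBondY x}
    (hb : b ∈ usegY x z c.1.2) {q : IBondY x.toKIdx} (hqb : usrc x q = b.src) : unitDistY x (pivIY x c) q ≤ (ℓ : ℝ) + 2 := by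
  have h1 := (tdistK_kLab_usrc_le x (pivIY x c)).1
  have h3 := (tdistK_kLab_usrc_le x q).1
  have hsrc : usrc x (pivIY x c) = (upivU x c.1).src := by
    unfold pivIY
    rw [usrc_idxOfU]
  have h2' := tdistK_upivU_src_le_of_mem_usegY x (isCoarseY_of x c).1 hz hb
  have h2 : tdistK (ℓ := ℓ) (Mh := x.Mh) (k := x.k) (P := x.P') (labK x (usrc x (pivIY x c))) (labK x (usrc x q)) ≤ ℓ := by
    rw [hsrc, hqb]
    exact h2'
  show tdistK (ℓ := ℓ) (Mh := x.Mh) (k := x.k) (P := x.P') (kLab x (pivIY x c)) (kLab x q) ≤ _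
  calc tdistK (ℓ := ℓ) (Mh := x.Mh) (k := x.k) (P := x.P') (kLab x (pivIY x c)) (kLab x q)
      ≤ tdistK (ℓ := ℓ) (Mh := x.Mh) (k := x.k) (P := x.P') (kLab x (pivIY x c)) (labK x (usrc x (pivIY x c))) +
          tdistK (ℓ := ℓ) (Mh := x.Mh) (k := x.k) (P := x.P') (labK x (usrc x (pivIY x c))) (kLab x q) := tdistK_triangle _ _ _
    _ ≤ tdistK (ℓ := ℓ) (Mh := x.Mh) (k := x.k) (P := x.P') (kLab x (pivIY x c)) (labK x (usrc x (pivIY x c))) +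
          (tdistK (ℓ := ℓ) (Mh := x.Mh) (k := x.k) (P := x.P') (labK x (usrc x (pivIY x c))) (labK x (usrc x q)) +
            tdistK (ℓ := ℓ) (Mh := x.Mh) (k := x.k) (P := x.P') (labK x (usrc x q)) (kLab x q)) :=
        add_le_add le_rfl (tdistK_triangle _ _ _)
    _ ≤ 1 + ((ℓ : ℝ) + 1) := add_le_add h1 (add_le_add h2 (by rw [tdistK_comm]; exact h3))
    _ = (ℓ : ℝ) + 2 := by ring

end Readings

/-! ## §3  LOCALITY of `C(V)` — every background, no hypothesis -/

section Locality

variable {𝔸 : Type} [NormedRing 𝔸] [NormedAlgebra ℂ 𝔸] [CompleteSpace 𝔸]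
variable (x : MemberY d ℓ hd hL w₀ w₁ Mstar) (𝔳 : AvY 𝔸 x)

/-- ★★ **LOCALITY OF `C(V)`**: `(C(V)(δ_q ⊗ w))(u) ≠ 0 ⟹ |y_u − y_q| ≤ ℓ + 2` on `T₁^{(k)}`, for EVERY background `U` and every averaged-field parameter `𝔳`
— `C` is the identity at `u = q ∈ Λ̃` and otherwise nonzero only at a pivot `u = b₀(c)` whose averaging `Q(V)_c` reads the unit bond of `q` on a segment
`[z, z(c)]`, `z ∈ B(c₋)` (print: *«an identity operator on almost all bonds, except the bonds b₀»*).  The radius `ℓ + 2` depends on `L` only.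
[cite: Balaban1985BackgroundPropagators, (3.157) p.428; Balaban1985Averaging, (125) p.36] -/
theorem unitDistY_le_of_elimCY_single_ne_zero [DecidableEq (IBondY x.toKIdx)] (U : CfgY 𝔸 x.toKIdx) (q : IBondY x.toKIdx) (w : 𝔸)
    {u : IBondY x.toKIdx} (h : elimCY x 𝔳 U (Pi.single q w) u ≠ 0) : unitDistY x u q ≤ (ℓ : ℝ) + 2 := by
  have hℓ : (0 : ℝ) ≤ (ℓ : ℝ) + 2 := by positivity
  by_cases hq : lamTY x q
  swap
  · exact absurd (by rw [elimCY_single_of_not_lamTY x 𝔳 U hq, Pi.zero_apply]) h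
  rw [elimCY_apply, secY_single_of hq] at h
  by_cases hu : u = q
  · subst hu
    show tdistK (ℓ := ℓ) (Mh := x.Mh) (k := x.k) (P := x.P') (kLab x u) (kLab x u) ≤ _
    rw [tdistK_self]
    exact hℓ
  rw [Pi.single_eq_of_ne hu, zero_sub, neg_ne_zero] at h
  obtain ⟨c, -, hc⟩ := Finset.exists_ne_zero_of_sum_ne_zero h
  by_cases huc : u = pivIY x c
  swap
  · rw [if_neg huc] at hc
    exact absurd rfl hc
  rw [if_pos huc] at hc
  have hQ : Q1Y x 𝔳 U c.1 (Pi.single q w) ≠ 0 := fun h0 => hc (by rw [h0, map_zero])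
  rw [Q1Y_apply] at hQ
  have hS : ∑ z ∈ ublockY x c.1.1, hol (RVY x 𝔳 U) (uΓ x z) (trSum (RUY x 𝔳 U) (readUY x (Pi.single q w)) (usegY x z c.1.2)) ≠ 0 :=
    fun h0 => hQ (by rw [h0, smul_zero])
  obtain ⟨z, hz, hzne⟩ := Finset.exists_ne_zero_of_sum_ne_zero hS
  have htr : trSum (RUY x 𝔳 U) (readUY x (Pi.single q w)) (usegY x z c.1.2) ≠ 0 := fun h0 => hzne (by rw [h0, map_zero])
  obtain ⟨b, hb, hbne⟩ : ∃ b ∈ usegY x z c.1.2, readUY x (Pi.single q w) b ≠ 0 := by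
    by_contra hall
    push Not at hall
    exact htr (trSum_eq_zero _ _ hall)
  have hbq : b = ubondOfIdx x q := by
    by_contra hne
    have hle := norm_readUY_single_le x q w b
    rw [if_neg hne] at hle
    exact hbne (norm_le_zero_iff.1 hle)
  have hqb : usrc x q = b.src := by rw [hbq]; rfl
  rw [huc]
  exact unitDistY_pivIY_le_of_mem_usegY x c hz hb hqb

end Locality

/-! ## §4  COLUMN MASS of `C(V)` for contracting transports and a bounded pivot inverse; the pivot-inverse row at `U = 1` and for small fields -/

section ColumnMass

variable {𝔸 : Type} [NormedRing 𝔸] [NormedAlgebra ℂ 𝔸] [CompleteSpace 𝔸]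
variable (x : MemberY d ℓ hd hL w₀ w₁ Mstar) (𝔳 : AvY 𝔸 x)

open Classical in
/-- ★ **`Q(V)_c` OF A ONE-BOND FUNCTION**: if `B` reads at most `M` at the unit bond `b₀` and `0` elsewhere and the transports `R(V(b))` contract, then
`‖(Q(V)B)(c)‖ ≤ L^{−(d+2)} · (Σ_{z ∈ B(c₋)} #(b₀ ∈ [z, z(c)])) · M` ((125): `L^{d+1}` segments of `L` bonds, carried back along the block contours).
[cite: Balaban1985Averaging, (124)–(125) p.36; Balaban1985BackgroundPropagators, (3.157) p.428] -/
theorem norm_Q1Y_le_of_reads {U : CfgY 𝔸 x.toKIdx} (hT : ∀ (b : UBondY x) (v : 𝔸), ‖RUY x 𝔳 U b v‖ ≤ ‖v‖) (B : IBondY x.toKIdx → 𝔸) (b₀ : UBondY x)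
    {M : ℝ} (hB : ∀ b, ‖readUY x B b‖ ≤ if b = b₀ then M else 0) (c : USiteY x × Fin (d + 1)) :
    ‖Q1Y x 𝔳 U c B‖ ≤ ((((ℓ + 1 : ℕ) : ℝ)) ^ (d + 2))⁻¹ * ((∑ z ∈ ublockY x c.1, occY b₀ (usegY x z c.2)) * M) := by
  have hT' : ∀ (p : IBondY x.toKIdx) (v : 𝔸), ‖RVY x 𝔳 U p v‖ ≤ ‖v‖ := fun p v => hT _ v
  rw [Q1Y_apply, norm_smul, norm_qNormY]
  refine mul_le_mul_of_nonneg_left ?_ (by positivity)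
  rw [Finset.sum_mul]
  refine (norm_sum_le _ _).trans (Finset.sum_le_sum fun z _ => ?_)
  exact (norm_hol_le _ hT' _ _).trans (norm_trSum_le_occY_mul _ hT _ b₀ hB _)

/-- ★★ **COLUMN MASS OF `C(V)`**: for contracting unit-bond transports `‖R(V(b))v‖ ≤ ‖v‖` and a PIVOT-INVERSE ROW `‖K_c(V)⁻¹a‖ ≤ κ_K·L^{d+1}·‖a‖` on `Λ′`,
`Σ_u ‖(C(V)(δ_q ⊗ w))(u)‖ ≤ (1 + κ_K)·‖w‖` for every index bond `q` and fibre value `w`: the identity part contributes `‖w‖` (at `u = q ∈ Λ̃`; nothing if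
`q ∉ Λ̃`), and the pivot rows together read the unit bond of `q` at most `L` times (`sum_sum_occY_usegY_le`), each time with weight `κ_K L^{d+1} · L^{−(d+2)}`.
[cite: Balaban1985BackgroundPropagators, (3.157) p.428; Balaban1985Averaging, (125) p.36] -/
theorem sum_norm_elimCY_single_le_of_contract [DecidableEq (IBondY x.toKIdx)] {U : CfgY 𝔸 x.toKIdx}
    (hT : ∀ (b : UBondY x) (v : 𝔸), ‖RUY x 𝔳 U b v‖ ≤ ‖v‖) {κK : ℝ} (hκK : 0 ≤ κK)
    (hK : ∀ (c : CBondY x) (a : 𝔸), ‖Ring.inverse (KY x 𝔳 U c) a‖ ≤ κK * (((ℓ + 1 : ℕ) : ℝ)) ^ (d + 1) * ‖a‖)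
    (q : IBondY x.toKIdx) (w : 𝔸) :
    ∑ u, ‖elimCY x 𝔳 U (Pi.single q w) u‖ ≤ (1 + κK) * ‖w‖ := by
  by_cases hq : lamTY x q
  swap
  · rw [elimCY_single_of_not_lamTY x 𝔳 U hq]
    simp only [Pi.zero_apply, norm_zero, Finset.sum_const_zero]
    positivity
  set L : ℝ := ((ℓ + 1 : ℕ) : ℝ) with hLdef
  have hL0 : 0 < L := by rw [hLdef]; exact_mod_cast Nat.succ_pos ℓ
  have hL1 : L ≠ 0 := hL0.ne'
  set X : CBondY x → ℝ := fun c => ‖Ring.inverse (KY x 𝔳 U c) (Q1Y x 𝔳 U c.1 (Pi.single q w))‖ with hX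
  have hpt : ∀ u, ‖elimCY x 𝔳 U (Pi.single q w) u‖ ≤
      ‖(Pi.single q w : IBondY x.toKIdx → 𝔸) u‖ + ∑ c : CBondY x, (if u = pivIY x c then X c else 0) := by
    intro u
    rw [elimCY_apply, secY_single_of hq]
    refine (norm_sub_le _ _).trans (add_le_add le_rfl ((norm_sum_le _ _).trans (Finset.sum_le_sum fun c _ => ?_)))
    split_ifs
    · exact le_rfl
    · rw [norm_zero]
  have hsum1 : ∑ u, ‖(Pi.single q w : IBondY x.toKIdx → 𝔸) u‖ = ‖w‖ := by
    rw [Finset.sum_eq_single q (fun u _ hu => by rw [Pi.single_eq_of_ne hu, norm_zero]) (fun h => absurd (Finset.mem_univ q) h),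
      Pi.single_eq_same]
  have hsum2 : ∑ u, ∑ c : CBondY x, (if u = pivIY x c then X c else 0) = ∑ c : CBondY x, X c := by
    rw [Finset.sum_comm]
    exact Finset.sum_congr rfl fun c _ => by rw [Finset.sum_ite_eq' Finset.univ (pivIY x c), if_pos (Finset.mem_univ _)]
  have hXle : ∀ c : CBondY x, X c ≤
      κK * L ^ (d + 1) * ((L ^ (d + 2))⁻¹ * ((∑ z ∈ ublockY x c.1.1, occY (ubondOfIdx x q) (usegY x z c.1.2)) * ‖w‖)) := by
    intro c
    refine (hK c _).trans (mul_le_mul_of_nonneg_left ?_ (by positivity))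
    exact norm_Q1Y_le_of_reads x 𝔳 hT (Pi.single q w) (ubondOfIdx x q) (norm_readUY_single_le x q w) c.1
  have hocc := sum_sum_occY_usegY_le x (ubondOfIdx x q)
  calc ∑ u, ‖elimCY x 𝔳 U (Pi.single q w) u‖
      ≤ ∑ u, (‖(Pi.single q w : IBondY x.toKIdx → 𝔸) u‖ + ∑ c : CBondY x, (if u = pivIY x c then X c else 0)) :=
        Finset.sum_le_sum fun u _ => hpt u
    _ = ‖w‖ + ∑ c : CBondY x, X c := by rw [Finset.sum_add_distrib, hsum1, hsum2]
    _ ≤ ‖w‖ + ∑ c : CBondY x,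
          κK * L ^ (d + 1) * ((L ^ (d + 2))⁻¹ * ((∑ z ∈ ublockY x c.1.1, occY (ubondOfIdx x q) (usegY x z c.1.2)) * ‖w‖)) :=
        add_le_add le_rfl (Finset.sum_le_sum fun c _ => hXle c)
    _ = ‖w‖ + κK * L ^ (d + 1) * (L ^ (d + 2))⁻¹ * ‖w‖ *
          ∑ c : CBondY x, ∑ z ∈ ublockY x c.1.1, occY (ubondOfIdx x q) (usegY x z c.1.2) := by
        rw [Finset.mul_sum]
        congr 1
        exact Finset.sum_congr rfl fun c _ => by ring
    _ ≤ ‖w‖ + κK * L ^ (d + 1) * (L ^ (d + 2))⁻¹ * ‖w‖ * L := add_le_add le_rfl (mul_le_mul_of_nonneg_left hocc (by positivity))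
    _ = (1 + κK) * ‖w‖ := by
        field_simp
        ring

/-- **COLUMN MASS, `G`-VALUED AVERAGED FIELD**: the same for `V = 𝔳 U` with values in a group `G` of contractions (`‖g‖ ≤ 1`), the currency of def-Y's
`rowMass_outerLY_le` (the transports `Ad V(b)` then contract). [cite: Balaban1985BackgroundPropagators, (3.157) p.428, (3.9) p.391; Balaban1985Averaging, (125) p.36] -/
theorem sum_norm_elimCY_single_le [DecidableEq (IBondY x.toKIdx)] {G : Subgroup 𝔸ˣ} (hG1 : ∀ g ∈ G, ‖((g : 𝔸ˣ) : 𝔸)‖ ≤ 1) {U : CfgY 𝔸 x.toKIdx}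
    (h𝔳 : ∀ b, 𝔳 U b ∈ G) {κK : ℝ} (hκK : 0 ≤ κK)
    (hK : ∀ (c : CBondY x) (a : 𝔸), ‖Ring.inverse (KY x 𝔳 U c) a‖ ≤ κK * (((ℓ + 1 : ℕ) : ℝ)) ^ (d + 1) * ‖a‖)
    (q : IBondY x.toKIdx) (w : 𝔸) :
    ∑ u, ‖elimCY x 𝔳 U (Pi.single q w) u‖ ≤ (1 + κK) * ‖w‖ :=
  sum_norm_elimCY_single_le_of_contract x 𝔳 (fun b v => by
    rw [RUY_apply]; exact B9Eq310Hermitian.norm_R_le (hG1 _ (h𝔳 b)) (hG1 _ (G.inv_mem (h𝔳 b))) v) hκK hK q w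

/-- ★ **THE PIVOT INVERSE AT `U = 1`**: `K_c(1)⁻¹ = L^{d+1}·id` (def-Y's `KY_one`: `K_c(1) = L^{−(d+1)}·id`, a unit).
[cite: Balaban1985BackgroundPropagators, p.428; Balaban1985Averaging, (125) p.36; Balaban1984PropagatorsII, (2.154) p.249] -/
theorem inverse_KY_one_apply (c : CBondY x) (a : 𝔸) :
    Ring.inverse (KY x (avYOfRecord x) (fun _ _ => 1 : CfgY 𝔸 x.toKIdx) c) a = (((ℓ + 1 : ℕ) : ℂ)) ^ (d + 1) • a := by
  have hK : IsUnit (KY x (avYOfRecord x) (fun _ _ => 1 : CfgY 𝔸 x.toKIdx) c) := isUnit_KY_one x c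
  have h := congrArg (fun T : Module.End ℂ 𝔸 => T a) (Ring.mul_inverse_cancel _ hK)
  simp only [Module.End.mul_apply, Module.End.one_apply] at h
  rw [KY_one] at h
  have hc : (((ℓ + 1 : ℕ) : ℂ)) ^ (d + 1) ≠ 0 := pow_ne_zero _ (Nat.cast_ne_zero.2 (Nat.succ_ne_zero ℓ))
  calc Ring.inverse (KY x (avYOfRecord x) (fun _ _ => 1 : CfgY 𝔸 x.toKIdx) c) a
      = (((ℓ + 1 : ℕ) : ℂ)) ^ (d + 1) •
          (((((ℓ + 1 : ℕ) : ℂ)) ^ (d + 1))⁻¹ • Ring.inverse (KY x (avYOfRecord x) (fun _ _ => 1 : CfgY 𝔸 x.toKIdx) c) a) := by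
        rw [smul_inv_smul₀ hc]
    _ = (((ℓ + 1 : ℕ) : ℂ)) ^ (d + 1) • a := by rw [h]

/-- **THE PIVOT-INVERSE ROW AT `U = 1`** with `κ_K = 1`: `‖K_c(1)⁻¹a‖ ≤ 1·L^{d+1}·‖a‖`. [cite: Balaban1985BackgroundPropagators, p.428; Balaban1985Averaging, (125) p.36, bookkeeping] -/
theorem norm_inverse_KY_one_apply_le (c : CBondY x) (a : 𝔸) :
    ‖Ring.inverse (KY x (avYOfRecord x) (fun _ _ => 1 : CfgY 𝔸 x.toKIdx) c) a‖ ≤ 1 * (((ℓ + 1 : ℕ) : ℝ)) ^ (d + 1) * ‖a‖ := by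
  rw [inverse_KY_one_apply, one_mul]
  refine (norm_smul_le _ _).trans (le_of_eq ?_)
  rw [norm_pow, Complex.norm_natCast]

/-- ★ **THE PIVOT-INVERSE ROW FOR SMALL FIELDS**: under def-Y's small-field hypotheses (`G`-valued contracting `V`, `‖V(b) − 1‖ ≤ δ`,
`κ := L^{d+1}·2δ(L + (d+1)ℓ) < 1`) `‖K_c(V)⁻¹a‖ ≤ (1 − κ)⁻¹·L^{d+1}·‖a‖` — `norm_KY_sub_le` (`‖L^{d+1}K_c(V)a − a‖ ≤ κ‖a‖`) and the unit property.
[cite: Balaban1985BackgroundPropagators, (3.35) p.397, p.428; Balaban1985Averaging, (125)–(126) p.36] -/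
theorem norm_inverse_KY_apply_le_of_small {G : Subgroup 𝔸ˣ} (hG1 : ∀ g ∈ G, ‖((g : 𝔸ˣ) : 𝔸)‖ ≤ 1) {U : CfgY 𝔸 x.toKIdx} (h𝔳 : ∀ b, 𝔳 U b ∈ G)
    {δ : ℝ} (hδ0 : 0 ≤ δ) (hδ : ∀ b, ‖((𝔳 U b : 𝔸ˣ) : 𝔸) - 1‖ ≤ δ)
    (hsmall : (((ℓ + 1 : ℕ) : ℝ)) ^ (d + 1) * (2 * δ * (((ℓ + 1 : ℕ) + (d + 1) * ℓ : ℕ) : ℝ)) < 1) (c : CBondY x) (a : 𝔸) :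
    ‖Ring.inverse (KY x 𝔳 U c) a‖ ≤
      (1 - (((ℓ + 1 : ℕ) : ℝ)) ^ (d + 1) * (2 * δ * (((ℓ + 1 : ℕ) + (d + 1) * ℓ : ℕ) : ℝ)))⁻¹ * (((ℓ + 1 : ℕ) : ℝ)) ^ (d + 1) * ‖a‖ := by
  have hLp0 : ((((ℓ + 1 : ℕ) : ℂ)) ^ (d + 1)) ≠ 0 := pow_ne_zero _ (Nat.cast_ne_zero.2 (Nat.succ_ne_zero ℓ))
  have hLpn : ‖(((ℓ + 1 : ℕ) : ℂ)) ^ (d + 1)‖ = (((ℓ + 1 : ℕ) : ℝ)) ^ (d + 1) := by rw [norm_pow, Complex.norm_natCast]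
  have hdev : ∀ a : 𝔸, ‖((((ℓ + 1 : ℕ) : ℂ)) ^ (d + 1) • KY x 𝔳 U c) a - a‖ ≤
      (((ℓ + 1 : ℕ) : ℝ)) ^ (d + 1) * (2 * δ * (((ℓ + 1 : ℕ) + (d + 1) * ℓ : ℕ) : ℝ)) * ‖a‖ := by
    intro a
    have e : ((((ℓ + 1 : ℕ) : ℂ)) ^ (d + 1) • KY x 𝔳 U c) a - a =
        (((ℓ + 1 : ℕ) : ℂ)) ^ (d + 1) • (KY x 𝔳 U c a - ((((ℓ + 1 : ℕ) : ℂ)) ^ (d + 1))⁻¹ • a) := by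
      rw [LinearMap.smul_apply, smul_sub, smul_inv_smul₀ hLp0]
    rw [e, norm_smul, hLpn, mul_assoc]
    exact mul_le_mul_of_nonneg_left (by simpa only [mul_assoc] using norm_KY_sub_le x 𝔳 hG1 h𝔳 hδ0 hδ c a) (by positivity)
  have h := norm_inverse_apply_le_of_norm_smul_sub_le (KY x 𝔳 U c) (isUnit_KY_of_small x 𝔳 hG1 h𝔳 hδ0 hδ hsmall c) hsmall hdev a
  rw [hLpn, div_eq_mul_inv, mul_comm ((((ℓ + 1 : ℕ) : ℝ)) ^ (d + 1))] at h
  exact h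

/-- the pivot-inverse row in def-Y's packaged small-field regime `SmallVY`. [cite: Balaban1985BackgroundPropagators, (3.35) p.397, p.428, bookkeeping] -/
theorem norm_inverse_KY_apply_le_of_smallVY {G : Subgroup 𝔸ˣ} {U : CfgY 𝔸 x.toKIdx} {δ : ℝ} (h : SmallVY x 𝔳 G U δ) (c : CBondY x) (a : 𝔸) :
    ‖Ring.inverse (KY x 𝔳 U c) a‖ ≤
      (1 - (((ℓ + 1 : ℕ) : ℝ)) ^ (d + 1) * (2 * δ * (((ℓ + 1 : ℕ) + (d + 1) * ℓ : ℕ) : ℝ)))⁻¹ * (((ℓ + 1 : ℕ) : ℝ)) ^ (d + 1) * ‖a‖ :=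
  norm_inverse_KY_apply_le_of_small x 𝔳 h.1 h.2.1 h.2.2.1 h.2.2.2.1 h.2.2.2.2 c a

/-- ★★ **COLUMN MASS OF `C(1)` AT THE RECORD's `U = 1`: `Σ_u ‖(C(1)(δ_q ⊗ w))(u)‖ ≤ 2‖w‖`** — no hypothesis ([4]'s flat parametrisation (2.154)–(2.156)).
[cite: Balaban1984PropagatorsII, (2.154)–(2.156) pp.249–250; Balaban1985BackgroundPropagators, (3.157) p.428] -/
theorem sum_norm_elimCY_single_le_one [DecidableEq (IBondY x.toKIdx)] (q : IBondY x.toKIdx) (w : 𝔸) :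
    ∑ u, ‖elimCY x (avYOfRecord x) (fun _ _ => 1 : CfgY 𝔸 x.toKIdx) (Pi.single q w) u‖ ≤ 2 * ‖w‖ :=
  (sum_norm_elimCY_single_le_of_contract x (avYOfRecord x) (U := fun _ _ => 1)
    (fun b v => le_of_eq (by rw [RUY_apply, avYOfRecord_one, R_one])) zero_le_one (norm_inverse_KY_one_apply_le x) q w).trans
    (by norm_num)

/-- ★★ **COLUMN MASS OF `C(V)` IN THE SMALL-FIELD REGIME**: `Σ_u ‖(C(V)(δ_q ⊗ w))(u)‖ ≤ (1 + (1 − κ)⁻¹)·‖w‖` under def-Y's `SmallVY x 𝔳 G U δ`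
(`κ := L^{d+1}·2δ(L + (d+1)ℓ)`). [cite: Balaban1985BackgroundPropagators, (3.157) p.428, (3.35) p.397; Balaban1985Averaging, (125)–(126) p.36] -/
theorem sum_norm_elimCY_single_le_of_smallVY [DecidableEq (IBondY x.toKIdx)] {G : Subgroup 𝔸ˣ} {U : CfgY 𝔸 x.toKIdx} {δ : ℝ}
    (h : SmallVY x 𝔳 G U δ) (q : IBondY x.toKIdx) (w : 𝔸) :
    ∑ u, ‖elimCY x 𝔳 U (Pi.single q w) u‖ ≤
      (1 + (1 - (((ℓ + 1 : ℕ) : ℝ)) ^ (d + 1) * (2 * δ * (((ℓ + 1 : ℕ) + (d + 1) * ℓ : ℕ) : ℝ)))⁻¹) * ‖w‖ :=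
  sum_norm_elimCY_single_le x 𝔳 h.1 h.2.1 (inv_nonneg.2 (sub_nonneg.2 h.2.2.2.2.le)) (norm_inverse_KY_apply_le_of_smallVY x 𝔳 h) q w

end ColumnMass

/-! ## §5  The consumer's shapes: rows `hloc` ∕ `hmass` of `B1Eq324BenfattoClassSectEMemberCoReadProduct.eq324_CsDeltaCY_precision_node00_on_unit`
at the seven-letter record `𝔢 := sectELettersYOfRecordTC x 𝔳 𝔢₀` -/

section Door

variable {𝔸 : Type} [NormedRing 𝔸] [NormedAlgebra ℂ 𝔸] [CompleteSpace 𝔸]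
variable (x : MemberY d ℓ hd hL w₀ w₁ Mstar) (𝔳 : AvY 𝔸 x)

/-- ★★ **ROW `hloc` OF THE PRECISION DOOR AT NODE 00's RECORD LETTERS, `r := ℓ + 2`, EVERY BACKGROUND**: for every placement `ι : σ → Λ̃`-bonds (in fact any
index bonds), `elimCΛY x 𝔢 U (δ_{ι s} ⊗ w) u ≠ 0 → |y_u − y_{ι s}| ≤ ℓ + 2` at `𝔢 := sectELettersYOfRecordTC x 𝔳 𝔢₀` (whose dressed `P_Λ C P_Λ̃` is `C(V)`,
def-Y's `elimCΛY_sectELettersYOfRecordTC`). [cite: Balaban1985BackgroundPropagators, (3.157) p.428, (3.187) p.432; Balaban1985UV3, (24) p.262] -/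
theorem local_elimCΛY_ofRecordTC [DecidableEq (IBondY x.toKIdx)] (𝔢₀ : SectELettersY 𝔸 x) (U : CfgY 𝔸 x.toKIdx) {σ : Type}
    (ι : σ → IBondY x.toKIdx) :
    ∀ (s : σ) (w : 𝔸) (u : IBondY x.toKIdx), elimCΛY x (sectELettersYOfRecordTC x 𝔳 𝔢₀) U (Pi.single (ι s) w) u ≠ 0 →
      unitDistY x u (ι s) ≤ (ℓ : ℝ) + 2 := by
  intro s w u h
  rw [elimCΛY_sectELettersYOfRecordTC] at h
  exact unitDistY_le_of_elimCY_single_ne_zero x 𝔳 U (ι s) w h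

/-- ★★ **ROW `hmass` OF THE PRECISION DOOR AT NODE 00's RECORD LETTERS, `m := (1 + κ_K)·n_e`**, for contracting transports, a pivot-inverse row with constant
`κ_K`, and any family `b : κ → 𝔸` of fibre vectors with `‖b c′‖ ≤ n_e` (the consumer's orthonormal basis).
[cite: Balaban1985BackgroundPropagators, (3.157) p.428; Balaban1985Averaging, (125) p.36; Balaban1985UV3, (24) p.262] -/
theorem colMass_elimCΛY_ofRecordTC_of_contract [DecidableEq (IBondY x.toKIdx)] (𝔢₀ : SectELettersY 𝔸 x) {U : CfgY 𝔸 x.toKIdx}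
    (hT : ∀ (b : UBondY x) (v : 𝔸), ‖RUY x 𝔳 U b v‖ ≤ ‖v‖) {κK : ℝ} (hκK : 0 ≤ κK)
    (hK : ∀ (c : CBondY x) (a : 𝔸), ‖Ring.inverse (KY x 𝔳 U c) a‖ ≤ κK * (((ℓ + 1 : ℕ) : ℝ)) ^ (d + 1) * ‖a‖)
    {κ : Type} (b : κ → 𝔸) {ne : ℝ} (hne : ∀ c', ‖b c'‖ ≤ ne) {σ : Type} (ι : σ → IBondY x.toKIdx) :
    ∀ (s : σ) (c' : κ), ∑ u, ‖elimCΛY x (sectELettersYOfRecordTC x 𝔳 𝔢₀) U (Pi.single (ι s) (b c')) u‖ ≤ (1 + κK) * ne := by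
  intro s c'
  rw [elimCΛY_sectELettersYOfRecordTC]
  exact (sum_norm_elimCY_single_le_of_contract x 𝔳 hT hκK hK (ι s) (b c')).trans (mul_le_mul_of_nonneg_left (hne c') (by positivity))

/-- **ROW `hmass`, `G`-VALUED AVERAGED FIELD** (def-Y's `hG1 ∕ h𝔳` currency). [cite: Balaban1985BackgroundPropagators, (3.157) p.428, (3.9) p.391; Balaban1985UV3, (24) p.262] -/
theorem colMass_elimCΛY_ofRecordTC [DecidableEq (IBondY x.toKIdx)] (𝔢₀ : SectELettersY 𝔸 x) {G : Subgroup 𝔸ˣ}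
    (hG1 : ∀ g ∈ G, ‖((g : 𝔸ˣ) : 𝔸)‖ ≤ 1) {U : CfgY 𝔸 x.toKIdx} (h𝔳 : ∀ b, 𝔳 U b ∈ G) {κK : ℝ} (hκK : 0 ≤ κK)
    (hK : ∀ (c : CBondY x) (a : 𝔸), ‖Ring.inverse (KY x 𝔳 U c) a‖ ≤ κK * (((ℓ + 1 : ℕ) : ℝ)) ^ (d + 1) * ‖a‖)
    {κ : Type} (b : κ → 𝔸) {ne : ℝ} (hne : ∀ c', ‖b c'‖ ≤ ne) {σ : Type} (ι : σ → IBondY x.toKIdx) :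
    ∀ (s : σ) (c' : κ), ∑ u, ‖elimCΛY x (sectELettersYOfRecordTC x 𝔳 𝔢₀) U (Pi.single (ι s) (b c')) u‖ ≤ (1 + κK) * ne :=
  colMass_elimCΛY_ofRecordTC_of_contract x 𝔳 𝔢₀ (fun b v => by
    rw [RUY_apply]; exact B9Eq310Hermitian.norm_R_le (hG1 _ (h𝔳 b)) (hG1 _ (G.inv_mem (h𝔳 b))) v) hκK hK b hne ι

/-- ★★ **ROW `hmass` AT `U = 1` OF THE RECORD, NO HYPOTHESIS**: `m := 2·n_e` (transports `= 1`, `K_c(1)⁻¹ = L^{d+1}`).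
[cite: Balaban1984PropagatorsII, (2.154)–(2.156) pp.249–250; Balaban1985BackgroundPropagators, (3.157) p.428; Balaban1985UV3, (24) p.262] -/
theorem colMass_elimCΛY_ofRecordTC_one [DecidableEq (IBondY x.toKIdx)] (𝔢₀ : SectELettersY 𝔸 x) {κ : Type} (b : κ → 𝔸) {ne : ℝ}
    (hne : ∀ c', ‖b c'‖ ≤ ne) {σ : Type} (ι : σ → IBondY x.toKIdx) :
    ∀ (s : σ) (c' : κ), ∑ u, ‖elimCΛY x (sectELettersYOfRecordTC x (avYOfRecord x) 𝔢₀) (fun _ _ => 1 : CfgY 𝔸 x.toKIdx)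
      (Pi.single (ι s) (b c')) u‖ ≤ 2 * ne := by
  intro s c'
  have h := colMass_elimCΛY_ofRecordTC_of_contract x (avYOfRecord x) 𝔢₀ (U := fun _ _ => 1)
    (fun b v => le_of_eq (by rw [RUY_apply, avYOfRecord_one, R_one])) zero_le_one (norm_inverse_KY_one_apply_le x) b hne ι s c'
  linarith

/-- ★★ **ROW `hmass` IN THE SMALL-FIELD REGIME**: `m := (1 + (1 − κ)⁻¹)·n_e` under def-Y's `SmallVY x 𝔳 G U δ`.
[cite: Balaban1985BackgroundPropagators, (3.157) p.428, (3.35) p.397; Balaban1985UV3, (24) p.262] -/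
theorem colMass_elimCΛY_ofRecordTC_of_smallVY [DecidableEq (IBondY x.toKIdx)] (𝔢₀ : SectELettersY 𝔸 x) {G : Subgroup 𝔸ˣ}
    {U : CfgY 𝔸 x.toKIdx} {δ : ℝ} (h : SmallVY x 𝔳 G U δ) {κ : Type} (b : κ → 𝔸) {ne : ℝ} (hne : ∀ c', ‖b c'‖ ≤ ne) {σ : Type}
    (ι : σ → IBondY x.toKIdx) :
    ∀ (s : σ) (c' : κ), ∑ u, ‖elimCΛY x (sectELettersYOfRecordTC x 𝔳 𝔢₀) U (Pi.single (ι s) (b c')) u‖ ≤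
      (1 + (1 - (((ℓ + 1 : ℕ) : ℝ)) ^ (d + 1) * (2 * δ * (((ℓ + 1 : ℕ) + (d + 1) * ℓ : ℕ) : ℝ)))⁻¹) * ne :=
  colMass_elimCΛY_ofRecordTC x 𝔳 𝔢₀ h.1 h.2.1 (inv_nonneg.2 (sub_nonneg.2 h.2.2.2.2.le)) (norm_inverse_KY_apply_le_of_smallVY x 𝔳 h) b hne ι

end Door

/-! ## §6  Record level: the rows at def-Y's v6 Sect. E letters `sectEYOfRecordV6` (fibre `M_N(ℂ)`, `G ≤ U(N)`) -/

section RecordV6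

open scoped Matrix.Norms.L2Operator
open B7Prop2Explicit (unitaryUnits)

variable (N : ℕ) (θ : Stage3Params) (M₆ : ℕ) (𝔢₀ : SectEY N θ M₆)

/-- ★★ **ROW `hloc` AT THE v6 RECORD**, every background: `r := ℓ + 2`. [cite: Balaban1985BackgroundPropagators, (3.157) p.428, (3.187) p.432; Balaban1985UV3, (24) p.262] -/
theorem local_elimC_sectEYOfRecordV6 (x : MemberY θ.d₆ θ.ℓ₆ θ.hd' θ.hL' θ.b₀ θ.b₁ M₆) [DecidableEq (IBondY x.toKIdx)]
    (U : CfgY (Matrix (Fin N) (Fin N) ℂ) x.toKIdx) {σ : Type} (ι : σ → IBondY x.toKIdx) :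
    ∀ (s : σ) (w : Matrix (Fin N) (Fin N) ℂ) (u : IBondY x.toKIdx),
      elimCΛY x (sectEYOfRecordV6 N θ M₆ 𝔢₀ x) U (Pi.single (ι s) w) u ≠ 0 → unitDistY x u (ι s) ≤ (θ.ℓ₆ : ℝ) + 2 :=
  local_elimCΛY_ofRecordTC x (avYOfRecord x) (𝔢₀ x) U ι

/-- ★★ **ROW `hmass` AT THE v6 RECORD, `U = 1`**: `m := 2·n_e`, no hypothesis. [cite: Balaban1984PropagatorsII, (2.154)–(2.156) pp.249–250; Balaban1985BackgroundPropagators, (3.157) p.428; Balaban1985UV3, (24) p.262] -/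
theorem colMass_elimC_sectEYOfRecordV6_one (x : MemberY θ.d₆ θ.ℓ₆ θ.hd' θ.hL' θ.b₀ θ.b₁ M₆) [DecidableEq (IBondY x.toKIdx)] {κ : Type}
    (b : κ → Matrix (Fin N) (Fin N) ℂ) {ne : ℝ} (hne : ∀ c', ‖b c'‖ ≤ ne) {σ : Type} (ι : σ → IBondY x.toKIdx) :
    ∀ (s : σ) (c' : κ), ∑ u, ‖elimCΛY x (sectEYOfRecordV6 N θ M₆ 𝔢₀ x) (fun _ _ => 1 : CfgY (Matrix (Fin N) (Fin N) ℂ) x.toKIdx)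
      (Pi.single (ι s) (b c')) u‖ ≤ 2 * ne :=
  colMass_elimCΛY_ofRecordTC_one x (𝔢₀ x) b hne ι

/-- ★★ **ROW `hmass` AT THE v6 RECORD IN THE SMALL-FIELD REGIME OF RECORD** (`G ≤ U(N)`, `G`-valued `U`, `‖avYOfRecord x U b − 1‖ ≤ δ`, smallness; def-Y's
`smallVY_avYOfRecord` supplies `SmallVY`): `m := (1 + (1 − κ)⁻¹)·n_e`. [cite: Balaban1985BackgroundPropagators, (3.157) p.428, (3.35) p.397, (3.40) p.397; Balaban1985UV3, (24) p.262] -/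
theorem colMass_elimC_sectEYOfRecordV6_of_smallVY (x : MemberY θ.d₆ θ.ℓ₆ θ.hd' θ.hL' θ.b₀ θ.b₁ M₆) [DecidableEq (IBondY x.toKIdx)]
    {G : Subgroup (Matrix (Fin N) (Fin N) ℂ)ˣ} {U : CfgY (Matrix (Fin N) (Fin N) ℂ) x.toKIdx} {δ : ℝ} (h : SmallVY x (avYOfRecord x) G U δ)
    {κ : Type} (b : κ → Matrix (Fin N) (Fin N) ℂ) {ne : ℝ} (hne : ∀ c', ‖b c'‖ ≤ ne) {σ : Type} (ι : σ → IBondY x.toKIdx) :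
    ∀ (s : σ) (c' : κ), ∑ u, ‖elimCΛY x (sectEYOfRecordV6 N θ M₆ 𝔢₀ x) U (Pi.single (ι s) (b c')) u‖ ≤
      (1 + (1 - (((θ.ℓ₆ + 1 : ℕ) : ℝ)) ^ (θ.d₆ + 1) * (2 * δ * (((θ.ℓ₆ + 1 : ℕ) + (θ.d₆ + 1) * θ.ℓ₆ : ℕ) : ℝ)))⁻¹) * ne :=
  colMass_elimCΛY_ofRecordTC_of_smallVY x (avYOfRecord x) (𝔢₀ x) h b hne ι

end RecordV6


/-! ## §7  (v1.1) The pivot-inverse row and the column mass of `C(V)` under SMALL CURVATURE (3.35): local smallness, gauge orbits, the axial gauge -/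

section SmallCurvature

open B7Prop1Explicit (U1 mem_U1)
open B8Lemma1NonAbelian (pairTop)

variable {𝔸 : Type} [NormedRing 𝔸] [NormedAlgebra ℂ 𝔸] [CompleteSpace 𝔸]
variable (x : MemberY d ℓ hd hL w₀ w₁ Mstar) (𝔳 𝔳' : AvY 𝔸 x)

/-- ★ **LOCAL SMALLNESS SUFFICES FOR THE PIVOT-INVERSE ROW**: membership in the group of contractions and `‖V(b) − 1‖ ≤ δ` are needed only on the bonds READ by
`K_c` (def-Y's `ReadsY x c`; the field truncated to `1` elsewhere has the same `K_c`, `KY_congr`). [cite: Balaban1985Averaging, (109) p.34, (124)–(126) p.36; Balaban1985BackgroundPropagators, (3.35) p.397, p.428] -/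
theorem norm_inverse_KY_apply_le_of_small_on {G : Subgroup 𝔸ˣ} (hG1 : ∀ g ∈ G, ‖((g : 𝔸ˣ) : 𝔸)‖ ≤ 1) {U : CfgY 𝔸 x.toKIdx} (c : CBondY x)
    (h𝔳 : ∀ b, ReadsY x c.1 b → 𝔳 U b ∈ G) {δ : ℝ} (hδ0 : 0 ≤ δ) (hδ : ∀ b, ReadsY x c.1 b → ‖((𝔳 U b : 𝔸ˣ) : 𝔸) - 1‖ ≤ δ)
    (hsmall : (((ℓ + 1 : ℕ) : ℝ)) ^ (d + 1) * (2 * δ * (((ℓ + 1 : ℕ) + (d + 1) * ℓ : ℕ) : ℝ)) < 1) (a : 𝔸) :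
    ‖Ring.inverse (KY x 𝔳 U c) a‖ ≤
      (1 - (((ℓ + 1 : ℕ) : ℝ)) ^ (d + 1) * (2 * δ * (((ℓ + 1 : ℕ) + (d + 1) * ℓ : ℕ) : ℝ)))⁻¹ * (((ℓ + 1 : ℕ) : ℝ)) ^ (d + 1) * ‖a‖ := by
  classical
  let 𝔳'' : AvY 𝔸 x := fun U' b => if ReadsY x c.1 b then 𝔳 U' b else 1
  have hag : ∀ b, ReadsY x c.1 b → 𝔳'' U b = 𝔳 U b := fun b hb => if_pos hb
  have hoff : ∀ b, ¬ ReadsY x c.1 b → 𝔳'' U b = 1 := fun b hb => if_neg hb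
  have h1 : ∀ b, 𝔳'' U b ∈ G := fun b => by
    by_cases hb : ReadsY x c.1 b
    · rw [hag b hb]; exact h𝔳 b hb
    · rw [hoff b hb]; exact G.one_mem
  have h2 : ∀ b, ‖((𝔳'' U b : 𝔸ˣ) : 𝔸) - 1‖ ≤ δ := fun b => by
    by_cases hb : ReadsY x c.1 b
    · rw [hag b hb]; exact hδ b hb
    · rw [hoff b hb, Units.val_one, sub_self, norm_zero]; exact hδ0
  rw [← KY_congr x 𝔳 𝔳'' c hag]
  exact norm_inverse_KY_apply_le_of_small x 𝔳'' hG1 h1 hδ0 h2 hsmall c a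

variable {γ : USiteY x → 𝔸ˣ} {U U' : CfgY 𝔸 x.toKIdx}

/-- ★ **`K_c(V)⁻¹` (as `Ring.inverse`) IS GAUGE COVARIANT**: `K_c(V^γ)⁻¹ Ad γ(c₋) = Ad γ(b₀(c)₋) K_c(V)⁻¹` — the `K_c` twin of def-Y's `ringInverse_KTY_ugauge`, from
`KY_ugauge_comp` (`K_c(V^γ) ∘ Ad γ(b₀(c)₋) = Ad γ(c₋) ∘ K_c(V)`) and the orbit invariance of invertibility (`isUnit_KY_ugauge_iff`; both sides `0` off the units).
[cite: Balaban1985BackgroundPropagators, (3.32)–(3.34) pp.395–396, (3.157) p.428] -/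
theorem ringInverse_KY_ugauge (hV : ∀ b, 𝔳' U' b = ugaugeY x γ (𝔳 U) b) (c : CBondY x) (w : 𝔸) :
    Ring.inverse (KY x 𝔳' U' c) (R (γ c.1.1) w) = R (γ (upivU x c.1).src) (Ring.inverse (KY x 𝔳 U c) w) := by
  by_cases hK : IsUnit (KY x 𝔳 U c)
  · obtain ⟨u', hu'⟩ := (isUnit_KY_ugauge_iff x 𝔳 𝔳' hV c).2 hK
    obtain ⟨u, hu⟩ := hK
    have h := KY_ugauge_comp x 𝔳 𝔳' hV c
    rw [← hu, ← hu'] at h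
    have h3 : ((u'⁻¹ : (Module.End ℂ 𝔸)ˣ) : Module.End ℂ 𝔸) * (adEquivY (γ c.1.1) : 𝔸 ≃ₗ[ℂ] 𝔸).toLinearMap =
        (adEquivY (γ (upivU x c.1).src) : 𝔸 ≃ₗ[ℂ] 𝔸).toLinearMap * ((u⁻¹ : (Module.End ℂ 𝔸)ˣ) : Module.End ℂ 𝔸) :=
      calc ((u'⁻¹ : (Module.End ℂ 𝔸)ˣ) : Module.End ℂ 𝔸) * (adEquivY (γ c.1.1) : 𝔸 ≃ₗ[ℂ] 𝔸).toLinearMap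
          = ((u'⁻¹ : (Module.End ℂ 𝔸)ˣ) : Module.End ℂ 𝔸) *
              ((adEquivY (γ c.1.1) : 𝔸 ≃ₗ[ℂ] 𝔸).toLinearMap * ((u : (Module.End ℂ 𝔸)ˣ) : Module.End ℂ 𝔸) *
                ((u⁻¹ : (Module.End ℂ 𝔸)ˣ) : Module.End ℂ 𝔸)) := by
            rw [Units.mul_inv_cancel_right]
        _ = ((u'⁻¹ : (Module.End ℂ 𝔸)ˣ) : Module.End ℂ 𝔸) *
              (((u' : (Module.End ℂ 𝔸)ˣ) : Module.End ℂ 𝔸) * (adEquivY (γ (upivU x c.1).src) : 𝔸 ≃ₗ[ℂ] 𝔸).toLinearMap *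
                ((u⁻¹ : (Module.End ℂ 𝔸)ˣ) : Module.End ℂ 𝔸)) := by
            rw [← h]
        _ = (adEquivY (γ (upivU x c.1).src) : 𝔸 ≃ₗ[ℂ] 𝔸).toLinearMap * ((u⁻¹ : (Module.End ℂ 𝔸)ˣ) : Module.End ℂ 𝔸) := by
            rw [mul_assoc ((u' : (Module.End ℂ 𝔸)ˣ) : Module.End ℂ 𝔸), Units.inv_mul_cancel_left]
    have h4 := congrArg (fun L : Module.End ℂ 𝔸 => L w) h3
    simp only [Module.End.mul_apply, LinearEquiv.coe_coe, adEquivY_apply] at h4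
    rw [← hu, ← hu', Ring.inverse_unit, Ring.inverse_unit]
    exact h4
  · have hK' : ¬ IsUnit (KY x 𝔳' U' c) := fun h => hK ((isUnit_KY_ugauge_iff x 𝔳 𝔳' hV c).1 h)
    rw [Ring.inverse_non_unit _ hK, Ring.inverse_non_unit _ hK', LinearMap.zero_apply, LinearMap.zero_apply, B9Eq39Adjoint.R_zero]

/-- ★ **THE PIVOT-INVERSE ROW IS A GAUGE-ORBIT PROPERTY** for gauges valued in a group of contractions: a bound `‖K_c(V^γ)⁻¹a‖ ≤ M‖a‖` transfers to
`‖K_c(V)⁻¹w‖ ≤ M‖w‖` (`K_c(V)⁻¹ = Ad γ(b₀(c)₋)⁻¹ ∘ K_c(V^γ)⁻¹ ∘ Ad γ(c₋)`, the `Ad`'s contract). [cite: Balaban1985BackgroundPropagators, (3.34) p.396, (3.35) p.397, (3.157) p.428] -/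
theorem norm_inverse_KY_apply_le_of_ugauge {G : Subgroup 𝔸ˣ} (hG1 : ∀ g ∈ G, ‖((g : 𝔸ˣ) : 𝔸)‖ ≤ 1) (hγ : ∀ s, γ s ∈ G)
    (hV : ∀ b, 𝔳' U' b = ugaugeY x γ (𝔳 U) b) (c : CBondY x) {M : ℝ} (hM : 0 ≤ M)
    (hK' : ∀ a, ‖Ring.inverse (KY x 𝔳' U' c) a‖ ≤ M * ‖a‖) (w : 𝔸) :
    ‖Ring.inverse (KY x 𝔳 U c) w‖ ≤ M * ‖w‖ := by
  have e : Ring.inverse (KY x 𝔳 U c) w = R (γ (upivU x c.1).src)⁻¹ (Ring.inverse (KY x 𝔳' U' c) (R (γ c.1.1) w)) := by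
    rw [ringInverse_KY_ugauge x 𝔳 𝔳' hV c w, B9Eq39Adjoint.R_inv_R]
  rw [e]
  have hi : ‖((((γ (upivU x c.1).src)⁻¹)⁻¹ : 𝔸ˣ) : 𝔸)‖ ≤ 1 := by rw [inv_inv]; exact hG1 _ (hγ _)
  calc ‖R (γ (upivU x c.1).src)⁻¹ (Ring.inverse (KY x 𝔳' U' c) (R (γ c.1.1) w))‖
      ≤ ‖Ring.inverse (KY x 𝔳' U' c) (R (γ c.1.1) w)‖ := B9Eq310Hermitian.norm_R_le (hG1 _ (G.inv_mem (hγ _))) hi _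
    _ ≤ M * ‖R (γ c.1.1) w‖ := hK' _
    _ ≤ M * ‖w‖ := mul_le_mul_of_nonneg_left (B9Eq310Hermitian.norm_R_le (hG1 _ (hγ _)) (hG1 _ (G.inv_mem (hγ _))) _) hM

/-- ★★ **THE PIVOT-INVERSE ROW UNDER SMALL CURVATURE ON THE DOUBLE BLOCK** (print's regime (3.35), via the axial gauge — def-Y's `isUnit_KY_of_plaqSmall` with a NORM):
for a `U1`-valued averaged field `V = 𝔳 U` whose plaquettes are `a`-small on `[c₋, c₋ + pairTop L μ]` and `κ_a := L^{d+1}·2(d(2ℓ+1)a)(L + (d+1)ℓ) < 1`,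
`‖K_c(V)⁻¹w‖ ≤ (1 − κ_a)⁻¹·L^{d+1}·‖w‖` — the axially gauged field `V^{axialY}` is `d(2ℓ+1)a`-small on the read bonds (`norm_ugaugeY_axialY_sub_one_le`), so the
local small-field row applies to it, and the bound transfers back along the orbit (`U1`-valued gauge).
[cite: Balaban1985BackgroundPropagators, (3.35) pp.396–397, (3.34) p.396, (3.157) p.428; Balaban1985Averaging, (55)–(58) p.27, (124)–(126) p.36; Balaban1985RegularSpaces, Lemma 1 p.79] -/
theorem norm_inverse_KY_apply_le_of_plaqSmall [NormOneClass 𝔸] (hVu : ∀ b, 𝔳 U b ∈ U1 𝔸) (c : CBondY x) {a : ℝ} (ha : 0 ≤ a)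
    (hP : B8Lemma1NonAbelian.PlaqSmall (VzY x (𝔳 U)) (labK x c.1.1) (labK x c.1.1 + pairTop (ℓ + 1) c.1.2) a)
    (hsmall : (((ℓ + 1 : ℕ) : ℝ)) ^ (d + 1) * (2 * ((((d * (2 * ℓ + 1) : ℕ) : ℝ)) * a) * (((ℓ + 1 : ℕ) + (d + 1) * ℓ : ℕ) : ℝ)) < 1) (w : 𝔸) :
    ‖Ring.inverse (KY x 𝔳 U c) w‖ ≤
      (1 - (((ℓ + 1 : ℕ) : ℝ)) ^ (d + 1) * (2 * ((((d * (2 * ℓ + 1) : ℕ) : ℝ)) * a) * (((ℓ + 1 : ℕ) + (d + 1) * ℓ : ℕ) : ℝ)))⁻¹ *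
        (((ℓ + 1 : ℕ) : ℝ)) ^ (d + 1) * ‖w‖ := by
  let 𝔳₁ : AvY 𝔸 x := fun U₁ => ugaugeY x (axialY x (𝔳 U) c.1.1) (𝔳 U₁)
  have hV₁ : ∀ b, 𝔳₁ U b = ugaugeY x (axialY x (𝔳 U) c.1.1) (𝔳 U) b := fun b => rfl
  have hG1 : ∀ g ∈ U1 𝔸, ‖((g : 𝔸ˣ) : 𝔸)‖ ≤ 1 := fun _ hg => (mem_U1.1 hg).1
  have hK₁ := norm_inverse_KY_apply_le_of_small_on x 𝔳₁ hG1 c (fun b _ => ugaugeY_axialY_mem x hVu c.1.1 b) (by positivity)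
    (fun b hb => norm_ugaugeY_axialY_sub_one_le x hVu c.1.1 c.1.2 ha hP (relY_add_unitVec_le_pairTop_of_readsY x c hb)) hsmall
  exact norm_inverse_KY_apply_le_of_ugauge x 𝔳 𝔳₁ hG1 (fun s => axialY_mem x hVu c.1.1 s) hV₁ c
    (mul_nonneg (inv_nonneg.2 (sub_nonneg.2 hsmall.le)) (by positivity)) (fun a' => hK₁ a') w

/-- ★★ **COLUMN MASS OF `C(V)` UNDER SMALL CURVATURE (3.35)**: for a `U1`-valued averaged field whose plaquettes are `a`-small on the double block of EVERY coarse bond,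
`Σ_u ‖(C(V)(δ_q ⊗ w))(u)‖ ≤ (1 + (1 − κ_a)⁻¹)·‖w‖`. [cite: Balaban1985BackgroundPropagators, (3.157) p.428, (3.35) p.397; Balaban1985Averaging, (125) p.36, (55)–(58) p.27] -/
theorem sum_norm_elimCY_single_le_of_plaqSmall [NormOneClass 𝔸] [DecidableEq (IBondY x.toKIdx)] (hVu : ∀ b, 𝔳 U b ∈ U1 𝔸) {a : ℝ} (ha : 0 ≤ a)
    (hP : ∀ c : CBondY x, B8Lemma1NonAbelian.PlaqSmall (VzY x (𝔳 U)) (labK x c.1.1) (labK x c.1.1 + pairTop (ℓ + 1) c.1.2) a)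
    (hsmall : (((ℓ + 1 : ℕ) : ℝ)) ^ (d + 1) * (2 * ((((d * (2 * ℓ + 1) : ℕ) : ℝ)) * a) * (((ℓ + 1 : ℕ) + (d + 1) * ℓ : ℕ) : ℝ)) < 1)
    (q : IBondY x.toKIdx) (w : 𝔸) :
    ∑ u, ‖elimCY x 𝔳 U (Pi.single q w) u‖ ≤
      (1 + (1 - (((ℓ + 1 : ℕ) : ℝ)) ^ (d + 1) * (2 * ((((d * (2 * ℓ + 1) : ℕ) : ℝ)) * a) * (((ℓ + 1 : ℕ) + (d + 1) * ℓ : ℕ) : ℝ)))⁻¹) * ‖w‖ :=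
  sum_norm_elimCY_single_le x 𝔳 (G := U1 𝔸) (fun _ hg => (mem_U1.1 hg).1) hVu (inv_nonneg.2 (sub_nonneg.2 hsmall.le))
    (fun c a' => norm_inverse_KY_apply_le_of_plaqSmall x 𝔳 hVu c ha (hP c) hsmall a') q w

/-- ★★ **ROW `hmass` UNDER SMALL CURVATURE (3.35)** at the seven-letter record: `m := (1 + (1 − κ_a)⁻¹)·n_e`.
[cite: Balaban1985BackgroundPropagators, (3.157) p.428, (3.35) p.397; Balaban1985UV3, (24) p.262] -/
theorem colMass_elimCΛY_ofRecordTC_of_plaqSmall [NormOneClass 𝔸] [DecidableEq (IBondY x.toKIdx)] (𝔢₀ : SectELettersY 𝔸 x) (hVu : ∀ b, 𝔳 U b ∈ U1 𝔸)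
    {a : ℝ} (ha : 0 ≤ a) (hP : ∀ c : CBondY x, B8Lemma1NonAbelian.PlaqSmall (VzY x (𝔳 U)) (labK x c.1.1) (labK x c.1.1 + pairTop (ℓ + 1) c.1.2) a)
    (hsmall : (((ℓ + 1 : ℕ) : ℝ)) ^ (d + 1) * (2 * ((((d * (2 * ℓ + 1) : ℕ) : ℝ)) * a) * (((ℓ + 1 : ℕ) + (d + 1) * ℓ : ℕ) : ℝ)) < 1)
    {κ : Type} (b : κ → 𝔸) {ne : ℝ} (hne : ∀ c', ‖b c'‖ ≤ ne) {σ : Type} (ι : σ → IBondY x.toKIdx) :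
    ∀ (s : σ) (c' : κ), ∑ u, ‖elimCΛY x (sectELettersYOfRecordTC x 𝔳 𝔢₀) U (Pi.single (ι s) (b c')) u‖ ≤
      (1 + (1 - (((ℓ + 1 : ℕ) : ℝ)) ^ (d + 1) * (2 * ((((d * (2 * ℓ + 1) : ℕ) : ℝ)) * a) * (((ℓ + 1 : ℕ) + (d + 1) * ℓ : ℕ) : ℝ)))⁻¹) * ne :=
  colMass_elimCΛY_ofRecordTC x 𝔳 𝔢₀ (G := U1 𝔸) (fun _ hg => (mem_U1.1 hg).1) hVu (inv_nonneg.2 (sub_nonneg.2 hsmall.le))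
    (fun c a' => norm_inverse_KY_apply_le_of_plaqSmall x 𝔳 hVu c ha (hP c) hsmall a') b hne ι

end SmallCurvature

section RecordV6Curvature

open scoped Matrix.Norms.L2Operator
open B7Prop1Explicit (U1 mem_U1)
open B7Prop2Explicit (unitaryUnits)
open B8Lemma1NonAbelian (pairTop)

variable (N : ℕ) (θ : Stage3Params) (M₆ : ℕ) (𝔢₀ : SectEY N θ M₆)

/-- ★★ **ROW `hmass` AT THE v6 RECORD UNDER (3.35) ON EVERY DOUBLE BLOCK** (`G ≤ U(N)`, `N ≥ 1`, `G`-valued `U`; `V = avYOfRecord x U` is `U1`-valued by the C⋆-norm):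
`m := (1 + (1 − κ_a)⁻¹)·n_e`. [cite: Balaban1985BackgroundPropagators, (3.157) p.428, (3.35) pp.396–397, (3.40) p.397; Balaban1985Averaging, (55)–(58) p.27; Balaban1985UV3, (24) p.262] -/
theorem colMass_elimC_sectEYOfRecordV6_of_plaqSmall [NeZero N] (x : MemberY θ.d₆ θ.ℓ₆ θ.hd' θ.hL' θ.b₀ θ.b₁ M₆) [DecidableEq (IBondY x.toKIdx)]
    {G : Subgroup (Matrix (Fin N) (Fin N) ℂ)ˣ} (hG : G ≤ unitaryUnits (Matrix (Fin N) (Fin N) ℂ)) {U : CfgY (Matrix (Fin N) (Fin N) ℂ) x.toKIdx}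
    (hU : ∀ μ z, U μ z ∈ G) {a : ℝ} (ha : 0 ≤ a)
    (hP : ∀ c : CBondY x, B8Lemma1NonAbelian.PlaqSmall (VzY x (avYOfRecord x U)) (labK x c.1.1) (labK x c.1.1 + pairTop (θ.ℓ₆ + 1) c.1.2) a)
    (hsmall : (((θ.ℓ₆ + 1 : ℕ) : ℝ)) ^ (θ.d₆ + 1) * (2 * ((((θ.d₆ * (2 * θ.ℓ₆ + 1) : ℕ) : ℝ)) * a) * (((θ.ℓ₆ + 1 : ℕ) + (θ.d₆ + 1) * θ.ℓ₆ : ℕ) : ℝ)) < 1)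
    {κ : Type} (b : κ → Matrix (Fin N) (Fin N) ℂ) {ne : ℝ} (hne : ∀ c', ‖b c'‖ ≤ ne) {σ : Type} (ι : σ → IBondY x.toKIdx) :
    ∀ (s : σ) (c' : κ), ∑ u, ‖elimCΛY x (sectEYOfRecordV6 N θ M₆ 𝔢₀ x) U (Pi.single (ι s) (b c')) u‖ ≤
      (1 + (1 - (((θ.ℓ₆ + 1 : ℕ) : ℝ)) ^ (θ.d₆ + 1) *
        (2 * ((((θ.d₆ * (2 * θ.ℓ₆ + 1) : ℕ) : ℝ)) * a) * (((θ.ℓ₆ + 1 : ℕ) + (θ.d₆ + 1) * θ.ℓ₆ : ℕ) : ℝ)))⁻¹) * ne :=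
  have hG1 := norm_coe_le_one_of_le_unitaryUnits hG
  colMass_elimCΛY_ofRecordTC_of_plaqSmall x (avYOfRecord x) (𝔢₀ x)
    (fun b' => mem_U1.2 ⟨hG1 _ (avYOfRecord_mem x hU b'), hG1 _ (G.inv_mem (avYOfRecord_mem x hU b'))⟩) ha hP hsmall b hne ι

end RecordV6Curvature

end Literature.MathematicalPhysics.QuantumFieldTheory.Balaban1983to89.B1Eq324BenfattoClassSectEMemberERowsAtNode00
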